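import Summits.CriticalPhenomena.Ising3DConformalLimit.Theses.HyperoctahedralRP
import Summits.CriticalPhenomena.Ising3DConformalLimit.Theorems.HyperoctahedralRPExistsScaleCovariantLimitDoublingOfDyadicPairRatio
import Summits.CriticalPhenomena.Ising3DConformalLimit.Theorems.HyperoctahedralRPExistsScaleCovariantLimitBlockDefs
import Summits.CriticalPhenomena.Ising3DConformalLimit.Theorems.HyperoctahedralRPExistsScaleCovariantLimitBlockMomentBounded
import Summits.CriticalPhenomena.Ising3DConformalLimit.Theorems.HyperoctahedralRPExistsScaleCovariantLimitBlockCovAlgebra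
import Summits.CriticalPhenomena.Ising3DConformalLimit.Theorems.HyperoctahedralRPExistsScaleCovariantLimitBlockCovTwoPointBounds
import Summits.CriticalPhenomena.Ising3DConformalLimit.Theorems.HyperoctahedralRPExistsScaleCovariantLimitTwoPointScalingOfLattice
import Summits.CriticalPhenomena.Ising3DConformalLimit.Theorems.HyperoctahedralRPExistsScaleCovariantLimitIntMeshOfBlockLimits
import HarnessLib

/-!
# Skeleton — crux `ExistsScaleCovariantLimit` (item stmt-CriticalPhenomena-1981), line `monotone-blocking-port`
(crux idea `Ideas/monotone-blocking-port.md`, ideator 4 round 2; lever of the summit card `monotone-blocking`;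
crux-plan planner-cruxplan-stmt-CriticalPhenomena-1981-monotone-blocking-po-0, 2026-08-16, v2b;
**v3, lead prover-line-stmt-CriticalPhenomena-1981-a1-0, 2026-08-16**: the vocabulary and every `Sig.stub_*`
statement now live in the LANDED definitions module `Theorems/HyperoctahedralRPExistsScaleCovariantLimitBlockDefs.lean`
(imported), and the planner's analysis stub S4 `BlockTwoLimits → TwoPointScaling` is RESHAPED into three registered
stubs S4a `stub_blockCovAlgebra` (lattice bookkeeping), S4b `stub_blockCovTwoPointBounds` (MMS sandwich + top-heavy
scales) and S4c `stub_twoPointScaling_of_lattice` (pure analysis), with S4 kept as the glue theorem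
`twoPointScaling_of_blockTwoLimits`; seven registered stubs in all, composition unchanged.
**v4, lead a1, 2026-08-16T22:1xZ**: S3, S4a, S4b, S4c, S5 LANDED (wave 1: p127548 `…BlockMomentBounded`, p127605
`…BlockCovAlgebra`, p127673 `…BlockCovTwoPointBounds`, p127769 `…TwoPointScalingOfLattice`, p128054 + p128267
`…IntMeshOfBlockLimits[Aux]`) and are IMPORTED; the only remaining `sorry`s are the two registered research stubs S1
`stub_monotoneBlockingTwo` and S2 `stub_monotoneBlockingHigher` = conjecture BM. Everything downstream of BM is now a
theorem: BM ⟹ crux, BM₂ ⟹ items 6150/4658/5955 + two-point scaling.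
**v5, lead prover-line-stmt-CriticalPhenomena-1981-c10-0, 2026-08-17T00:2xZ**: stubs unchanged (S1, S2), re-registered by the
second lead of this line; S1 held, S2 to one stub-worker; line verdict this seat.)

LEVER. MONOTONE + BOUNDED ⇒ CONVERGENT, applied to the normalisation-free BLOCK moments of the one critical
measure: `R_n(L; k⃗) = Σ_{xᵢ ∈ cube L} ⟨∏ᵢ σ_{xᵢ + L kᵢ}⟩_{β_c} / V(L)^{n/2}`, `V(L) = Σ_{x,y ∈ cube L} ⟨σ_xσ_y⟩_{β_c}`
(`critBlockMoment`, `blockCov`). CONJECTURE BM (eventual form): for every order `n` and injective offset vector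
`k⃗ ∈ (ℤ³)ⁿ`, `L ↦ R_n(L;k⃗)` is EVENTUALLY MONOTONE.

CHAIN (composition `ExistsScaleCovariantLimit_of`, sorry-free given the two conjecture stubs S1, S2; S3–S5 landed):
  BM₂ (S1 `stub_monotoneBlockingTwo`) ∧ BM_{≥3} (S2 `stub_monotoneBlockingHigher`) ∧ bounds (S3 `stub_blockMomentBounded`)
    ⟹ every block moment of order ≥ 2 converges along the FULL integer filter `L → ∞`
      (landed `MonotoneRGZoomGlue.tendsto_of_eventually_monotone_of_bounded`);
  block two-point limits ⟹ (S4 = S4c ∘ (S4a, S4b): all-integer ratio limits of the monotone `V`, Messager–Miracle-Solé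
      ℓ¹/ℓ^∞ cube sandwiches, frequent top-heaviness) `m⁶g(m)/V(m) → Φ > 0` and `g(jm)/g(m) → r_j > 0`
      (`TwoPointScaling`: the axial two-point function is REGULARLY VARYING); in particular the dyadic pair ratio
      `g(2^{k+1})/g(2^k)` converges
    ⟹ item 6150 `TwoPointDoubling` (landed D6 `stub_twoPointDoubling_of_dyadicPairRatio`, p123864)
    ⟹ item 4658 `UniformRegularity` (landed `ItemMaps.uniformRegularity_of_doubling`, p120504) — NOT a stub here;
  all block limits + two-point scaling + equicontinuity ⟹ (S5 `stub_intMesh_of_blockLimits`, de-smearing)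
      integer-mesh convergence of the PINNED zoom at integer configurations
    ⟹ the crux (landed `TwoHierarchies.crux_iff_intMeshConvergence`, p123864).

Disproof.lean v8 (cycle 2) honoured: no `_false_without_` theorem exists; §A pure existence is what the chain
delivers; §E the DSI family `W_ε` VIOLATES BM (log-periodic block ratios), so BM is admissible input beyond
two-point axiomatics; §H/§K both halves (compactness = 6150 via the n = 2 output, uniqueness via monotone
convergence); landed `Theorems/ZoomMonotone/Negative/*` (axis facts decide neither monotonicity nor
convergence of `g(2k)/g(k)`): consistent — BM₂ is extra input, and S4 consumes block LIMITS, not axis facts.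
Dead lines avoided: Sketch (no engine; here BM is the engine), BlockZoomSupport (`FieldMomentConvergence`
restated the smeared crux; here the smeared convergence is an OUTPUT of a lattice inequality and the tail is the
pinned one), SketchU.
-/

noncomputable section

namespace Summit.CriticalPhenomena.Ising3DConformalLimit.Cruxes.ExistsScaleCovariantLimit.MonotoneBlockingPort

open Literature.Probability.LatticeModels Filter Set
open scoped Topology BigOperators
open Summit.CriticalPhenomena.Ising3DConformalLimit.MoebiusLimitExistsOnlyInteraction (rhoPin)
open Summit.CriticalPhenomena.Ising3DConformalLimit.Theses
open Summit.CriticalPhenomena.Ising3DConformalLimit.Cruxes.ExistsScaleCovariantLimit.TwoHierarchies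
open Summit.CriticalPhenomena.Ising3DConformalLimit.MonotoneRGZoomGlue (tendsto_of_eventually_monotone_of_bounded)

/-! ## Stubs (the two remaining registered `sorry`s — conjecture BM; S3, S4a, S4b, S4c, S5 are imported theorems) -/

/-- **S1 `stub_monotoneBlockingTwo`** — see `Sig.stub_monotoneBlockingTwo`. OPEN (conjecture BM₂). -/
theorem stub_monotoneBlockingTwo : Sig.stub_monotoneBlockingTwo := by
  sorry

/-- **S2 `stub_monotoneBlockingHigher`** — see `Sig.stub_monotoneBlockingHigher`. OPEN (conjecture BM, n ≥ 3). -/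
theorem stub_monotoneBlockingHigher : Sig.stub_monotoneBlockingHigher := by
  sorry

/-! ## Glue (sorry-free given the stubs) -/

/-- **S4 (planner's v2b stub, now glue).** Block two-point limits force two-point scaling: S4c applied to the
lattice facts S4a and S4b. [folklore] -/
theorem twoPointScaling_of_blockTwoLimits (h4a : Sig.stub_blockCovAlgebra) (h4b : Sig.stub_blockCovTwoPointBounds)
    (h4c : Sig.stub_twoPointScaling_of_lattice) : Sig.stub_twoPointScaling_of_blockTwoLimits :=
  h4c h4a h4b

/-- Monotone + bounded ⇒ convergent: under S1, S2, S3 every block moment of order `≥ 2` at distinct block positions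
converges along the full integer filter (landed `MonotoneRGZoomGlue.tendsto_of_eventually_monotone_of_bounded`). [folklore] -/
theorem blockLimits_of_monotone (h1 : Sig.stub_monotoneBlockingTwo) (h2 : Sig.stub_monotoneBlockingHigher)
    (h3 : Sig.stub_blockMomentBounded) : BlockLimits := by
  intro n hn k hk
  obtain ⟨C, hC⟩ := h3 n k
  have hbd : ∀ᶠ L in atTop, |critBlockMoment n L k| ≤ C :=
    (eventually_ge_atTop 1).mono fun L hL => hC L hL
  rcases Nat.lt_or_ge 2 n with hlt | hle
  · obtain ⟨L₀, hmono⟩ := h2 n hlt k hk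
    exact tendsto_of_eventually_monotone_of_bounded hmono hbd
  · have hn2 : n = 2 := le_antisymm hle hn
    subst hn2
    obtain ⟨L₀, hmono⟩ := h1 k hk
    exact tendsto_of_eventually_monotone_of_bounded hmono hbd

/-- The n = 2 case alone (S1 + S3). [folklore] -/
theorem blockTwoLimits_of_monotone (h1 : Sig.stub_monotoneBlockingTwo) (h3 : Sig.stub_blockMomentBounded) :
    BlockTwoLimits := by
  intro k hk
  obtain ⟨C, hC⟩ := h3 2 k
  obtain ⟨L₀, hmono⟩ := h1 k hk
  exact tendsto_of_eventually_monotone_of_bounded hmono ((eventually_ge_atTop 1).mono fun L hL => hC L hL)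

/-- `TwoPointScaling` (ii) at `j = 2` gives the dyadic pair ratio: the pinned pair zoom at `(0, 2e₀)` along `2^{-k}` is
`g(2^{k+1})/g(2^k)` exactly (`pz_two_geomPair`). [folklore] -/
theorem dyadicPairRatio_of_scaling (hscal : TwoPointScaling) :
    ∃ L : ℝ, Tendsto (fun k : ℕ => rescaledCorrelator (criticalCorr 3) rhoPin 2 (((2:ℝ) ^ k)⁻¹)
        (![0, EuclideanSpace.single 0 (2:ℝ)] : Fin 2 → EuclideanSpace ℝ (Fin 3))) atTop (𝓝 L) := by
  obtain ⟨r, -, hr⟩ := hscal.2 2 (by norm_num)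
  refine ⟨r, ?_⟩
  have hpow : Tendsto (fun k : ℕ => 2 ^ k) atTop atTop := tendsto_pow_atTop_atTop_of_one_lt one_lt_two
  refine (hr.comp hpow).congr fun k => ?_
  have e := pz_two_geomPair 2 1 k
  simp only [Nat.cast_ofNat, pow_one] at e
  rw [Function.comp_apply, e, pow_add, pow_one]

/-- **n = 2 MILESTONE (sorry-free given S1, S3, S4a–c): BM₂ ⟹ item 6150 `TwoPointDoubling`** (hence item 5955
`OrbitPrecompact` and item 4658 `UniformRegularity` by the landed F5/D6 chains) — existence of `η(3)` in the
regular-variation sense comes with `TwoPointScaling`. -/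
theorem twoPointDoubling_of_blockTwo (h1 : Sig.stub_monotoneBlockingTwo) (h3 : Sig.stub_blockMomentBounded)
    (h4 : Sig.stub_twoPointScaling_of_blockTwoLimits) : MirrorHoelderCompactness.TwoPointDoubling :=
  stub_twoPointDoubling_of_dyadicPairRatio (dyadicPairRatio_of_scaling (h4 (blockTwoLimits_of_monotone h1 h3)))

/-- Item 4658 from the n = 2 output (landed `ItemMaps.uniformRegularity_of_doubling`, p120504). -/
theorem uniformRegularity_of_blockTwo (h1 : Sig.stub_monotoneBlockingTwo) (h3 : Sig.stub_blockMomentBounded)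
    (h4 : Sig.stub_twoPointScaling_of_blockTwoLimits) : MonotoneRG.UniformRegularity :=
  ItemMaps.uniformRegularity_of_doubling (twoPointDoubling_of_blockTwo h1 h3 h4)

/-! ## Composition -/

/-- **COMPOSITION (v4).** The crux from the two remaining stubs S1, S2 (conjecture BM), each a registered stub statement BY
NAME; the five landed stubs are used as theorems: block limits (S1, S2 + landed S3, monotone convergence) → two-point
scaling (landed S4a, S4b, S4c) → dyadic pair ratio → item 6150 (D6, landed) → item 4658 (`uniformRegularity_of_doubling`,
landed) → integer-mesh convergence of the pinned zoom (landed S5) → the crux (`TwoHierarchies.crux_iff_intMeshConvergence`,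
landed). -/
theorem ExistsScaleCovariantLimit_of :
    Sig.stub_monotoneBlockingTwo → Sig.stub_monotoneBlockingHigher →
      Summit.CriticalPhenomena.Ising3DConformalLimit.Theses.HyperoctahedralRP.ExistsScaleCovariantLimit := by
  intro h1 h2
  -- (o) the planner's S4 as a theorem (S4c applied to S4a, S4b — all landed)
  have h4 : Sig.stub_twoPointScaling_of_blockTwoLimits :=
    twoPointScaling_of_blockTwoLimits stub_blockCovAlgebra stub_blockCovTwoPointBounds stub_twoPointScaling_of_lattice
  -- (i) every block moment of order ≥ 2 converges (S3 landed)
  have hlim : BlockLimits := blockLimits_of_monotone h1 h2 stub_blockMomentBounded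
  -- (ii) two-point scaling from the block two-point limits
  have hscal : TwoPointScaling := h4 (blockTwoLimits_of_monotone h1 stub_blockMomentBounded)
  -- (iii) dyadic pair ratio ⟹ item 6150 ⟹ item 4658 (landed D6 + F5 chains)
  have hUR : MonotoneRG.UniformRegularity := uniformRegularity_of_blockTwo h1 stub_blockMomentBounded h4
  -- (iv) de-smearing (S5 landed), then the landed lattice form of the crux
  exact crux_iff_intMeshConvergence.2 (stub_intMesh_of_blockLimits hlim hscal hUR)

/-- The composition applied to the stubs (closed modulo the two conjecture `sorry`s S1, S2). -/
theorem ExistsScaleCovariantLimit_proof :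
    Summit.CriticalPhenomena.Ising3DConformalLimit.Theses.HyperoctahedralRP.ExistsScaleCovariantLimit :=
  ExistsScaleCovariantLimit_of stub_monotoneBlockingTwo stub_monotoneBlockingHigher

end Summit.CriticalPhenomena.Ising3DConformalLimit.Cruxes.ExistsScaleCovariantLimit.MonotoneBlockingPort

end
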